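import Literature.Topology.FourManifolds.HomotopySpheres
import Literature.Topology.FourManifolds.EquidimensionalEmbedding

/-!
# Line `stable-seam-host` (crux `OrigamiFoldExistence`, stmt-SmoothPoincare4-7844): stub `stub_seamShell`

Registry v2 (lead c10), registered stub `stub_seamShell` of the line `stable-seam-host` of crux
`Summit.SmoothPoincare4.SmoothPoincare4.Theses.SymplecticOrigami.OrigamiFoldExistence`.

The line reduces the crux to statements about the seam `J(e(S³))` of the fake ball
`Δ_e = S ∖ e(B̊⁴)` of a homotopy 4-sphere `S` inside a host `X`.  This file is the formal
transport step: if `e : ℝ⁴ ↪ S` is a smooth embedding of the chart ball and `J : S → X` is `C^∞`,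
injective and has bijective differential on an open `U ⊇ (e(B̊⁴))ᶜ` (`EmbedsFakeBallNhd`), then
`J ∘ e : ℝ⁴ → X` is `C^∞`, injective and has bijective differential on the open set
`V = e⁻¹(U) ⊇ S³` (`IsShellEmbedding`): `e` is continuous and injective, so `V` is open and no
point of the unit sphere is hit by `e(B̊⁴)`; and `e` is an equidimensional smooth embedding, hence
a local diffeomorphism (tree theorem
`Manifold.IsSmoothEmbedding.isLocalDiffeomorph_of_finrank_eq`), so its differential is bijective
and the chain rule (`mfderiv_comp`) transfers bijectivity to `d(J ∘ e)`.

No definitions, no named facts, no `sorry`.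
-/

noncomputable section

-- the prescribed namespace `Summit.<P>.<Sub>.…` duplicates `SmoothPoincare4` (P = Sub)
set_option linter.dupNamespace false

open scoped Manifold ContDiff Topology
open Set Function

namespace Summit.SmoothPoincare4.SmoothPoincare4.Theorems.OrigamiFoldExistence.StableSeamHost

open Literature.Topology.FourManifolds

/-- **Seam shell** (registered stub `stub_seamShell` of line `stable-seam-host`): if the chart
ball `e : ℝ⁴ ↪ S` is a smooth embedding into a homotopy 4-sphere and `J : S → X` is a `C^∞`
injective map with bijective differential on an open neighbourhood `U` of the fake ball
`S ∖ e(B̊⁴)`, then `J ∘ e` is a `C^∞` injective map with bijective differential on the open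
neighbourhood `e⁻¹(U)` of the unit sphere `S³ ⊆ ℝ⁴` (an equidimensional smooth embedding is a
local diffeomorphism, Hirsch Ch. 1 §3; chain rule). [folklore] -/
theorem stub_seamShell : ∀ (S : Literature.Topology.FourManifolds.HomotopySphere 4) (e : EuclideanSpace ℝ (Fin 4) → S.carrier) (X : Type) [TopologicalSpace X] [ChartedSpace (EuclideanSpace ℝ (Fin 4)) X] [IsManifold (𝓡 4) ∞ X] (J : S.carrier → X), Manifold.IsSmoothEmbedding (𝓡 4) (𝓡 4) ∞ e → (∃ U : Set S.carrier, IsOpen U ∧ (e '' Metric.ball (0 : EuclideanSpace ℝ (Fin 4)) 1)ᶜ ⊆ U ∧ ContMDiffOn (𝓡 4) (𝓡 4) ∞ J U ∧ Set.InjOn J U ∧ ∀ x ∈ U, Function.Bijective (mfderiv (𝓡 4) (𝓡 4) J x)) → (∃ V : Set (EuclideanSpace ℝ (Fin 4)), IsOpen V ∧ Metric.sphere (0 : EuclideanSpace ℝ (Fin 4)) 1 ⊆ V ∧ ContMDiffOn (𝓡 4) (𝓡 4) ∞ (J ∘ e) V ∧ Set.InjOn (J ∘ e) V ∧ ∀ u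 ∈ V, Function.Bijective (mfderiv (𝓡 4) (𝓡 4) (J ∘ e) u)) := by
  intro S e X _ _ _ J he hJ
  obtain ⟨U, hUo, hUc, hs, hi, hd⟩ := hJ
  -- `e` is continuous, injective, differentiable, and a local diffeomorphism (equal dimension)
  have hec : Continuous e := he.contMDiff.continuous
  have heinj : Injective e := he.isEmbedding.injective
  have hed : ∀ u, MDifferentiableAt (𝓡 4) (𝓡 4) e u := fun _ =>
    he.contMDiff.mdifferentiableAt (by simp)
  have hloc : IsLocalDiffeomorph (𝓡 4) (𝓡 4) ∞ e := he.isLocalDiffeomorph_of_finrank_eq rfl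
  have hbe : ∀ u, Bijective (mfderiv (𝓡 4) (𝓡 4) e u) := fun u =>
    ((hloc u).mfderivToContinuousLinearEquiv (by simp)).bijective
  -- `J` is differentiable at the points of the open set `U`
  have hJd : ∀ x ∈ U, MDifferentiableAt (𝓡 4) (𝓡 4) J x := fun x hx =>
    ((hs x hx).contMDiffAt (hUo.mem_nhds hx)).mdifferentiableAt (by simp)
  refine ⟨e ⁻¹' U, hUo.preimage hec, ?_, ?_, ?_, ?_⟩
  · -- the unit sphere lies in `V = e⁻¹(U)`: `e u ∉ e(B̊⁴)` for `‖u‖ = 1`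
    intro u hu
    refine hUc ?_
    rintro ⟨z, hz, hzu⟩
    obtain rfl : z = u := heinj hzu
    rw [mem_sphere_zero_iff_norm] at hu
    rw [Metric.mem_ball, dist_zero_right, hu] at hz
    exact lt_irrefl _ hz
  · -- smoothness
    exact hs.comp he.contMDiff.contMDiffOn fun u hu => hu
  · -- injectivity
    intro u hu v hv huv
    exact heinj (hi hu hv huv)
  · -- bijective differential (chain rule)
    intro u hu
    have hx : e u ∈ U := hu
    rw [mfderiv_comp u (hJd _ hx) (hed u)]
    exact (hd _ hx).comp (hbe u)

end Summit.SmoothPoincare4.SmoothPoincare4.Theorems.OrigamiFoldExistence.StableSeamHost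

end
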